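import Mathlib.Analysis.SpecialFunctions.Pow.Real
import Mathlib.Analysis.SpecialFunctions.Log.Basic
import HarnessLib

/-!
# Heath-Brown's Lemma 3.10, §13 p. 83: the parameter bookkeeping ("budget" inequalities)

Support for the proof of **Lemma 3.10** of D. R. Heath-Brown, *Primes represented by `x³ + 2y³`*,
Acta Math. 186 (2001), §13 p. 83:

> "Taken in conjunction with our estimate (13.4) for the terms with `Q₀ < q ≤ d₀` we therefore deduce
> that `S₈ ≪ XV(YQ₀⁴ exp{−c√(log L)} + YQ₀^{1/2} … + YQ₀^{−1/2} + Y⁴⁶X^{−τ/2})(log X)^c`. We now choose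
> `Q₀ = Q₁^{1/2}` … whence Lemma 12.2 yields
> `S_V ≪ X²(Y^{−1/2} + Y³⁰X^{−τ/4} + Y⁸Q₁^{−1/8} + Y⁸Q₁² exp{−c√(log L)})(log X)^c`."

Pure real inequalities PROVING that each term of the bounds for `S₁`, `S₃`, `S₄⁺` and the tail fits one of
the four target terms `XV·{Y⁻¹, Y⁶⁰X^{−τ/2}, Y¹⁶Q₁^{−1/4}, Y¹⁶Q₁⁴e^{−c₁√(log L)}}`, in the variables
`X, Y, T = V^{1/3}, N, Q₁, Q₀, W = X^{τ/2}` under the standing relations (`Y² ≤ N ≤ 4992Y²`,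
`Q₁^{1/3}/2 ≤ Q₀ ≤ Q₁^{1/3}`, `XW ≤ T³`, `T²W ≤ X`, `Y¹⁰Q₁ ≤ T²`, `c₅XY³ ≤ T³`, …). Our choice is
`Q₀ = Q₁^{1/3}` (Hölder with exponent `3` in place of the pointwise divisor bound), giving `Q₁^{−1/3} ≤ Q₁^{−1/4}`.

## References

* D. R. Heath-Brown, *Primes represented by `x³ + 2y³`*, Acta Math. 186 (2001), §13 p. 83.
  [cite: HeathBrownActa2001, §13 p. 83]

## Mathlib / tree search

Mathlib only (`Real.rpow_*`, `nlinarith`).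
-/

noncomputable section

namespace Literature.NumberTheory.Sieve.CubicSieve

/-! ### `S₁` and the tail -/

/-- `X² ≤ (XT³/W)·Y⁶⁰` from `XW ≤ T³`, `W > 0`, `Y ≥ 1`. [folklore] -/
theorem budget_S1 {X Y T W : ℝ} (hX : 0 ≤ X) (hY : 1 ≤ Y) (hW : 0 < W) (hXW : X * W ≤ T ^ 3) :
    X ^ 2 ≤ X * T ^ 3 / W * Y ^ 60 := by
  have h1 : X ≤ T ^ 3 / W := by rw [le_div_iff₀ hW]; exact hXW
  have hY60 : 1 ≤ Y ^ 60 := one_le_pow₀ hY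
  have hT0 : 0 ≤ T ^ 3 / W := hX.trans h1
  calc X ^ 2 = X * X * 1 := by ring
    _ ≤ X * (T ^ 3 / W) * Y ^ 60 := by gcongr
    _ = X * T ^ 3 / W * Y ^ 60 := by ring

/-- The tail: `T⁶/d₀ + T⁵ ≤ XT³/Y + (XT³/W)Y⁶⁰` with `d₀ = T³Y⁷/X`, `T²W ≤ X`. [folklore] -/
theorem budget_TL {X Y T W : ℝ} (hX : 0 < X) (hY : 1 ≤ Y) (hT : 0 < T) (hW : 0 < W) (hTW : T ^ 2 * W ≤ X) :
    T ^ 6 / (T ^ 3 * Y ^ 7 / X) + T ^ 5 ≤ X * T ^ 3 / Y + X * T ^ 3 / W * Y ^ 60 := by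
  have hY0 : 0 < Y := by linarith
  have e1 : T ^ 6 / (T ^ 3 * Y ^ 7 / X) = X * T ^ 3 / Y ^ 7 := by field_simp
  rw [e1]
  have h1 : X * T ^ 3 / Y ^ 7 ≤ X * T ^ 3 / Y := by
    apply div_le_div_of_nonneg_left (by positivity) hY0
    calc Y = Y ^ 1 := (pow_one Y).symm
      _ ≤ Y ^ 7 := pow_le_pow_right₀ hY (by norm_num)
  have h2 : T ^ 5 ≤ X * T ^ 3 / W * Y ^ 60 := by
    have hY60 : 1 ≤ Y ^ 60 := one_le_pow₀ hY
    have : T ^ 2 ≤ X / W := by rw [le_div_iff₀ hW]; exact hTW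
    calc T ^ 5 = T ^ 2 * T ^ 3 * 1 := by ring
      _ ≤ (X / W) * T ^ 3 * Y ^ 60 := by gcongr
      _ = X * T ^ 3 / W * Y ^ 60 := by ring
  linarith

/-! ### `S₃` -/

/-- `Δ₀(6T + Δ₀)(56X/T² + 1)² ≤ 87808 X/Y` for `Δ₀ = T³/(XY) ≤ T`, `T² ≤ 56X`. [folklore] -/
theorem budget_S3 {X Y T Δ₀ : ℝ} (hX : 0 < X) (hY : 1 ≤ Y) (hT : 0 < T) (hΔ : Δ₀ = T ^ 3 / (X * Y))
    (hΔT : Δ₀ ≤ T) (hT56 : T ^ 2 ≤ 56 * X) :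
    Δ₀ * (6 * T + Δ₀) * (56 * X / T ^ 2 + 1) ^ 2 ≤ 87808 * X / Y := by
  have hY0 : 0 < Y := by linarith
  have hΔ0 : 0 ≤ Δ₀ := by rw [hΔ]; positivity
  have h1 : 6 * T + Δ₀ ≤ 7 * T := by linarith
  have h2 : 56 * X / T ^ 2 + 1 ≤ 112 * X / T ^ 2 := by
    rw [div_add_one (by positivity), div_le_div_iff_of_pos_right (by positivity)]; linarith
  have h20 : 0 ≤ 56 * X / T ^ 2 + 1 := by positivity
  calc Δ₀ * (6 * T + Δ₀) * (56 * X / T ^ 2 + 1) ^ 2 ≤ Δ₀ * (7 * T) * (112 * X / T ^ 2) ^ 2 := by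
        gcongr
    _ = 87808 * X / Y := by rw [hΔ]; field_simp; ring

/-! ### The Class II cells -/

/-- `2XYT³/N + 3X²Y² ≤ (2 + 3/c₅)·XT³/Y` from `Y² ≤ N`, `c₅XY³ ≤ T³`. [folklore] -/
theorem budget_classII {X Y T N c₅ : ℝ} (hX : 0 < X) (hY : 1 ≤ Y) (hT : 0 < T) (hc₅ : 0 < c₅)
    (hN : Y ^ 2 ≤ N) (hV : c₅ * X * Y ^ 3 ≤ T ^ 3) :
    2 * X * Y * T ^ 3 / N + 3 * X ^ 2 * Y ^ 2 ≤ (2 + 3 / c₅) * (X * T ^ 3 / Y) := by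
  have hY0 : 0 < Y := by linarith
  have hN0 : 0 < N := lt_of_lt_of_le (by positivity) hN
  have h1 : 2 * X * Y * T ^ 3 / N ≤ 2 * (X * T ^ 3 / Y) := by
    rw [div_le_iff₀ hN0]
    calc 2 * X * Y * T ^ 3 = 2 * (X * T ^ 3 / Y) * Y ^ 2 := by field_simp
      _ ≤ 2 * (X * T ^ 3 / Y) * N := by gcongr
  have h2 : 3 * X ^ 2 * Y ^ 2 ≤ 3 / c₅ * (X * T ^ 3 / Y) := by
    rw [div_mul_eq_mul_div, le_div_iff₀ hc₅, mul_div_assoc', le_div_iff₀ hY0]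
    nlinarith [mul_le_mul_of_nonneg_left hV (by positivity : 0 ≤ 3 * X)]
  calc 2 * X * Y * T ^ 3 / N + 3 * X ^ 2 * Y ^ 2 ≤ 2 * (X * T ^ 3 / Y) + 3 / c₅ * (X * T ^ 3 / Y) := add_le_add h1 h2
    _ = (2 + 3 / c₅) * (X * T ^ 3 / Y) := by ring

/-! ### The large sieve range -/

/-- `XYT³·(8/Q₀ + 4d₀/s + d₀³/s³) ≤ 16·XT³Y¹⁶Q₁^{−1/4} + (19968 + 4992³)·(XT³/W)Y⁶⁰` with `d₀ = T³Y⁷/X`,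
`s = T/N`, `N ≤ 4992Y²`, `Q₁^{1/3}/2 ≤ Q₀`, `T²W ≤ X`, `W ≥ 1`. [folklore] -/
theorem budget_large {X Y T N Q₁ Q₀ W : ℝ} (hX : 0 < X) (hY : 1 ≤ Y) (hT : 0 < T) (hN0 : 0 < N)
    (hN : N ≤ 4992 * Y ^ 2) (hQ₁ : 1 ≤ Q₁) (hQ₀ : Q₁ ^ (1 / 3 : ℝ) / 2 ≤ Q₀) (hW : 1 ≤ W) (hTW : T ^ 2 * W ≤ X) :
    X * Y * T ^ 3 * (8 / Q₀ + 4 * (T ^ 3 * Y ^ 7 / X) / (T / N) + (T ^ 3 * Y ^ 7 / X) ^ 3 / (T / N) ^ 3) ≤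
      16 * (X * T ^ 3 * Y ^ 16 * Q₁ ^ (-(1 / 4 : ℝ))) + (19968 + 4992 ^ 3) * (X * T ^ 3 / W * Y ^ 60) := by
  have hY0 : 0 < Y := by linarith
  have hW0 : 0 < W := by linarith
  have hQ₁0 : 0 < Q₁ := by linarith
  have hQ13 : 1 ≤ Q₁ ^ (1 / 3 : ℝ) := Real.one_le_rpow hQ₁ (by norm_num)
  have hQ₀0 : 0 < Q₀ := lt_of_lt_of_le (by positivity) hQ₀
  -- (i) `8XYT³/Q₀ ≤ 16 XYT³ Q₁^{-1/3} ≤ 16 XT³Y^{16}Q₁^{-1/4}`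
  have h1 : X * Y * T ^ 3 * (8 / Q₀) ≤ 16 * (X * T ^ 3 * Y ^ 16 * Q₁ ^ (-(1 / 4 : ℝ))) := by
    have hinv : 8 / Q₀ ≤ 16 * Q₁ ^ (-(1 / 3 : ℝ)) := by
      rw [div_le_iff₀ hQ₀0, Real.rpow_neg hQ₁0.le]
      have : (16 : ℝ) * (Q₁ ^ (1 / 3 : ℝ))⁻¹ * Q₀ ≥ 16 * (Q₁ ^ (1 / 3 : ℝ))⁻¹ * (Q₁ ^ (1 / 3 : ℝ) / 2) := by gcongr
      have e : (16 : ℝ) * (Q₁ ^ (1 / 3 : ℝ))⁻¹ * (Q₁ ^ (1 / 3 : ℝ) / 2) = 8 := by field_simp; norm_num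
      linarith
    have hmono : Q₁ ^ (-(1 / 3 : ℝ)) ≤ Q₁ ^ (-(1 / 4 : ℝ)) := Real.rpow_le_rpow_of_exponent_le hQ₁ (by norm_num)
    have hY16 : Y ≤ Y ^ 16 := by
      calc Y = Y ^ 1 := (pow_one Y).symm
        _ ≤ Y ^ 16 := pow_le_pow_right₀ hY (by norm_num)
    have hq0 : 0 ≤ Q₁ ^ (-(1 / 3 : ℝ)) := Real.rpow_nonneg hQ₁0.le _
    calc X * Y * T ^ 3 * (8 / Q₀) ≤ X * Y * T ^ 3 * (16 * Q₁ ^ (-(1 / 3 : ℝ))) := by gcongr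
      _ = 16 * (X * T ^ 3 * Y * Q₁ ^ (-(1 / 3 : ℝ))) := by ring
      _ ≤ 16 * (X * T ^ 3 * Y ^ 16 * Q₁ ^ (-(1 / 4 : ℝ))) := by gcongr
  -- (ii) `4XYT³d₀/s = 4Y⁸T⁵N ≤ 19968 Y^{10}T⁵ ≤ 19968 XT³Y⁶⁰/W`
  have h2 : X * Y * T ^ 3 * (4 * (T ^ 3 * Y ^ 7 / X) / (T / N)) ≤ 19968 * (X * T ^ 3 / W * Y ^ 60) := by
    have e : X * Y * T ^ 3 * (4 * (T ^ 3 * Y ^ 7 / X) / (T / N)) = 4 * Y ^ 8 * T ^ 5 * N := by field_simp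
    rw [e]
    have hT2 : T ^ 2 ≤ X / W := by rw [le_div_iff₀ hW0]; exact hTW
    have hY60 : Y ^ 10 ≤ Y ^ 60 := pow_le_pow_right₀ hY (by norm_num)
    calc 4 * Y ^ 8 * T ^ 5 * N ≤ 4 * Y ^ 8 * T ^ 5 * (4992 * Y ^ 2) := by gcongr
      _ = 19968 * (T ^ 2 * T ^ 3 * Y ^ 10) := by ring
      _ ≤ 19968 * ((X / W) * T ^ 3 * Y ^ 60) := by gcongr
      _ = 19968 * (X * T ^ 3 / W * Y ^ 60) := by ring
  -- (iii) `XYT³d₀³/s³ = Y²²N³T⁹/X² ≤ 4992³ Y²⁸T⁹/X² ≤ 4992³ XT³Y⁶⁰/W`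
  have h3 : X * Y * T ^ 3 * ((T ^ 3 * Y ^ 7 / X) ^ 3 / (T / N) ^ 3) ≤ 4992 ^ 3 * (X * T ^ 3 / W * Y ^ 60) := by
    have e : X * Y * T ^ 3 * ((T ^ 3 * Y ^ 7 / X) ^ 3 / (T / N) ^ 3) = Y ^ 22 * N ^ 3 * T ^ 9 / X ^ 2 := by
      field_simp
    rw [e]
    -- `T⁶ W ≤ X³` from `T²W ≤ X`, `W ≥ 1`
    have hT6 : T ^ 6 * W ≤ X ^ 3 := by
      have h := pow_le_pow_left₀ (by positivity) hTW 3
      have hW3 : W ≤ W ^ 3 := by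
        calc W = W ^ 1 := (pow_one W).symm
          _ ≤ W ^ 3 := pow_le_pow_right₀ hW (by norm_num)
      calc T ^ 6 * W ≤ T ^ 6 * W ^ 3 := by gcongr
        _ = (T ^ 2 * W) ^ 3 := by ring
        _ ≤ X ^ 3 := h
    rw [div_le_iff₀ (by positivity)]
    have hY60 : Y ^ 28 ≤ Y ^ 60 := pow_le_pow_right₀ hY (by norm_num)
    have hN3 : N ^ 3 ≤ (4992 * Y ^ 2) ^ 3 := pow_le_pow_left₀ hN0.le hN 3
    calc Y ^ 22 * N ^ 3 * T ^ 9 ≤ Y ^ 22 * (4992 * Y ^ 2) ^ 3 * T ^ 9 := by gcongr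
      _ = 4992 ^ 3 * (T ^ 3 * Y ^ 28) * (T ^ 6 * W) / W := by field_simp
      _ ≤ 4992 ^ 3 * (T ^ 3 * Y ^ 60) * X ^ 3 / W := by gcongr
      _ = 4992 ^ 3 * (X * T ^ 3 / W * Y ^ 60) * X ^ 2 := by field_simp
  have e : X * Y * T ^ 3 * (8 / Q₀ + 4 * (T ^ 3 * Y ^ 7 / X) / (T / N) + (T ^ 3 * Y ^ 7 / X) ^ 3 / (T / N) ^ 3) =
      X * Y * T ^ 3 * (8 / Q₀) + X * Y * T ^ 3 * (4 * (T ^ 3 * Y ^ 7 / X) / (T / N)) +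
        X * Y * T ^ 3 * ((T ^ 3 * Y ^ 7 / X) ^ 3 / (T / N) ^ 3) := by ring
  rw [e]
  linarith

/-! ### The small moduli -/

/-- The (3.14) part: `N⁶ Y Q₀⁷ Q₁² e^{−2u} ≤ 4992⁶ Y¹⁶ Q₁⁴ e^{−u}` from `N ≤ 4992Y²`, `Q₀ ≤ Q₁^{1/3}`,
`Q₁^{1/3} e^{−u} ≤ 1`. [folklore] -/
theorem budget_hyp {Y N Q₁ Q₀ u : ℝ} (hY : 1 ≤ Y) (hN0 : 0 ≤ N) (hN : N ≤ 4992 * Y ^ 2) (hQ₁ : 1 ≤ Q₁)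
    (hQ₀0 : 0 ≤ Q₀) (hQ₀ : Q₀ ≤ Q₁ ^ (1 / 3 : ℝ)) (hu : Q₁ ^ (1 / 3 : ℝ) * Real.exp (-u) ≤ 1) :
    N ^ 6 * Y * Q₀ ^ 7 * Q₁ ^ 2 * Real.exp (-(2 * u)) ≤ 4992 ^ 6 * (Y ^ 16 * Q₁ ^ 4 * Real.exp (-u)) := by
  have hQ₁0 : 0 < Q₁ := by linarith
  have hq : 0 ≤ Q₁ ^ (1 / 3 : ℝ) := Real.rpow_nonneg hQ₁0.le _
  have hN6 : N ^ 6 ≤ (4992 * Y ^ 2) ^ 6 := pow_le_pow_left₀ hN0 hN 6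
  have hQ7 : Q₀ ^ 7 ≤ (Q₁ ^ (1 / 3 : ℝ)) ^ 7 := pow_le_pow_left₀ hQ₀0 hQ₀ 7
  have e7 : (Q₁ ^ (1 / 3 : ℝ)) ^ 7 = Q₁ ^ 2 * Q₁ ^ (1 / 3 : ℝ) := by
    rw [← Real.rpow_natCast, ← Real.rpow_mul hQ₁0.le, show (1 / 3 : ℝ) * (7 : ℕ) = 2 + 1 / 3 by norm_num,
      Real.rpow_add hQ₁0, Real.rpow_two]
  have hexp : Real.exp (-(2 * u)) = Real.exp (-u) * Real.exp (-u) := by rw [← Real.exp_add]; ring_nf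
  have hY16 : Y ^ 13 ≤ Y ^ 16 := pow_le_pow_right₀ hY (by norm_num)
  have he0 : 0 < Real.exp (-u) := Real.exp_pos _
  calc N ^ 6 * Y * Q₀ ^ 7 * Q₁ ^ 2 * Real.exp (-(2 * u))
      ≤ (4992 * Y ^ 2) ^ 6 * Y * (Q₁ ^ (1 / 3 : ℝ)) ^ 7 * Q₁ ^ 2 * Real.exp (-(2 * u)) := by gcongr
    _ = 4992 ^ 6 * (Y ^ 13 * Q₁ ^ 4 * Real.exp (-u)) * (Q₁ ^ (1 / 3 : ℝ) * Real.exp (-u)) := by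
        rw [e7, hexp]; ring
    _ ≤ 4992 ^ 6 * (Y ^ 16 * Q₁ ^ 4 * Real.exp (-u)) * 1 := by gcongr
    _ = 4992 ^ 6 * (Y ^ 16 * Q₁ ^ 4 * Real.exp (-u)) := by ring

/-- The Hölder tail, first part: `N⁶XY Q₀⁵ s⁶/(T³Q₁²) = XYT³Q₀⁵/Q₁² ≤ XT³Y¹⁶Q₁^{−1/4}` (`Q₀ ≤ Q₁^{1/3}`).
[folklore] -/
theorem budget_va {X Y T Q₁ Q₀ : ℝ} (hX : 0 ≤ X) (hY : 1 ≤ Y) (hT : 0 ≤ T) (hQ₁ : 1 ≤ Q₁) (hQ₀0 : 0 ≤ Q₀)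
    (hQ₀ : Q₀ ≤ Q₁ ^ (1 / 3 : ℝ)) :
    X * Y * T ^ 3 * Q₀ ^ 5 / Q₁ ^ 2 ≤ X * T ^ 3 * Y ^ 16 * Q₁ ^ (-(1 / 4 : ℝ)) := by
  have hQ₁0 : 0 < Q₁ := by linarith
  have hQ5 : Q₀ ^ 5 ≤ (Q₁ ^ (1 / 3 : ℝ)) ^ 5 := pow_le_pow_left₀ hQ₀0 hQ₀ 5
  have e5 : (Q₁ ^ (1 / 3 : ℝ)) ^ 5 / Q₁ ^ 2 = Q₁ ^ (-(1 / 3 : ℝ)) := by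
    rw [← Real.rpow_natCast, ← Real.rpow_mul hQ₁0.le, ← Real.rpow_two, ← Real.rpow_sub hQ₁0]; norm_num
  have hmono : Q₁ ^ (-(1 / 3 : ℝ)) ≤ Q₁ ^ (-(1 / 4 : ℝ)) := Real.rpow_le_rpow_of_exponent_le hQ₁ (by norm_num)
  have hY16 : Y ≤ Y ^ 16 := by
    calc Y = Y ^ 1 := (pow_one Y).symm
      _ ≤ Y ^ 16 := pow_le_pow_right₀ hY (by norm_num)
  have hq0 : 0 ≤ Q₁ ^ (-(1 / 3 : ℝ)) := Real.rpow_nonneg hQ₁0.le _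
  calc X * Y * T ^ 3 * Q₀ ^ 5 / Q₁ ^ 2 ≤ X * Y * T ^ 3 * (Q₁ ^ (1 / 3 : ℝ)) ^ 5 / Q₁ ^ 2 := by gcongr
    _ = X * T ^ 3 * Y * Q₁ ^ (-(1 / 3 : ℝ)) := by rw [← e5]; ring
    _ ≤ X * T ^ 3 * Y ^ 16 * Q₁ ^ (-(1 / 4 : ℝ)) := by gcongr

/-- The Hölder tail, second and third parts: `XY N²T Q₁ ≤ 4992² XT³/Y` and `XY N⁴ T Q₁ ≤ 4992⁴ XT³/Y`
from `N ≤ 4992Y²`, `Y¹⁰Q₁ ≤ T²`. [folklore] -/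
theorem budget_vbc {X Y T N Q₁ : ℝ} (hX : 0 ≤ X) (hY : 1 ≤ Y) (hT : 0 ≤ T) (hN0 : 0 ≤ N) (hN : N ≤ 4992 * Y ^ 2)
    (hQ₁ : 0 ≤ Q₁) (hYQ : Y ^ 10 * Q₁ ≤ T ^ 2) :
    X * Y * N ^ 2 * T * Q₁ ≤ 4992 ^ 2 * (X * T ^ 3 / Y) ∧ X * Y * N ^ 4 * T * Q₁ ≤ 4992 ^ 4 * (X * T ^ 3 / Y) := by
  have hY0 : 0 < Y := by linarith
  have hY6Q : Y ^ 6 * Q₁ ≤ T ^ 2 := by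
    have : Y ^ 6 * Q₁ ≤ Y ^ 10 * Q₁ := by
      have : Y ^ 6 ≤ Y ^ 10 := pow_le_pow_right₀ hY (by norm_num)
      exact mul_le_mul_of_nonneg_right this hQ₁
    linarith
  constructor
  · calc X * Y * N ^ 2 * T * Q₁ ≤ X * Y * (4992 * Y ^ 2) ^ 2 * T * Q₁ := by gcongr
      _ = 4992 ^ 2 * (X * T / Y) * (Y ^ 6 * Q₁) := by field_simp
      _ ≤ 4992 ^ 2 * (X * T / Y) * T ^ 2 := by gcongr
      _ = 4992 ^ 2 * (X * T ^ 3 / Y) := by ring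
  · calc X * Y * N ^ 4 * T * Q₁ ≤ X * Y * (4992 * Y ^ 2) ^ 4 * T * Q₁ := by gcongr
      _ = 4992 ^ 4 * (X * T / Y) * (Y ^ 10 * Q₁) := by field_simp
      _ ≤ 4992 ^ 4 * (X * T / Y) * T ^ 2 := by gcongr
      _ = 4992 ^ 4 * (X * T ^ 3 / Y) := by ring

/-! ### Logarithms -/

/-- `(log s)^{2e/3} ≤ (log X)^e` for `0 ≤ log s ≤ log X`, `1 ≤ log X`. [folklore] -/
theorem rpow_log_le {ls lX : ℝ} (h0 : 0 ≤ ls) (h1 : ls ≤ lX) (hX : 1 ≤ lX) (e : ℕ) :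
    ls ^ ((2 : ℝ) / 3 * e) ≤ lX ^ e := by
  rcases le_or_gt ls 1 with hle | hgt
  · calc ls ^ ((2 : ℝ) / 3 * e) ≤ 1 := Real.rpow_le_one h0 hle (by positivity)
      _ ≤ lX ^ e := one_le_pow₀ hX
  · calc ls ^ ((2 : ℝ) / 3 * e) ≤ ls ^ ((e : ℕ) : ℝ) :=
          Real.rpow_le_rpow_of_exponent_le hgt.le (by
            have : (0:ℝ) ≤ e := Nat.cast_nonneg e
            nlinarith)
      _ = ls ^ e := Real.rpow_natCast _ _
      _ ≤ lX ^ e := pow_le_pow_left₀ h0 h1 e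

/-- `(C s³ ℓ^e)^{2/3} = C^{2/3} s² (ℓ^e)^{2/3}` (`C, s, ℓ ≥ 0`). [folklore] -/
theorem rpow_two_thirds_mul {C s ℓ : ℝ} (hC : 0 ≤ C) (hs : 0 ≤ s) (hℓ : 0 ≤ ℓ) (e : ℕ) :
    (C * s ^ 3 * ℓ ^ e) ^ (2 / 3 : ℝ) = C ^ (2 / 3 : ℝ) * s ^ 2 * ℓ ^ ((2 : ℝ) / 3 * e) := by
  rw [Real.mul_rpow (by positivity) (by positivity), Real.mul_rpow hC (by positivity)]
  congr 1
  · congr 1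
    rw [← Real.rpow_natCast, ← Real.rpow_mul hs]; norm_num
  · rw [← Real.rpow_natCast, ← Real.rpow_mul hℓ, mul_comm]

end Literature.NumberTheory.Sieve.CubicSieve

end
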